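import Mathlib
import Summits.Ventures.PercRepro2.SwOutAll
import Summits.Ventures.PercRepro2.SwOutMixedArmsThm

/-!
# The several-arms big-block lemma, block-lowerness form and edge-set form (blind cell PercRepro2,
night-4 g20, 2026-08-27; proofs/NIGHT4-G20.md §4)

`mixedArms_card_le'`: lowerness is only needed BETWEEN NON-LEAKING POINTS (apply `mixedArms_card_le`
to the down-closure of the non-leaking part of `Q`; the two points of a `G5` instance are
non-leaking).  `card_le_of_mixedArms_edges`: the edge-set interface a geometric chain for a junction
with several mixed arms plugs into (the twin of `BigBlock.card_le_of_mixedCore_edges`).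
-/

namespace Summit.Ventures.PercRepro2

namespace MixedArms

open scoped Classical

variable {ι ρ ν κ : Type*}

section BlockLower

variable (arm : ν → ρ) (Q : Set (PtR ι ρ ν κ))

/-- Lowerness ON THE BLOCK ONLY: `q ≤ p` with both non-leaking and `p ∈ Q` gives `q ∈ Q`. -/
def BlockLower : Prop := ∀ p q, ¬ Leak p arm → ¬ Leak q arm → q ≤ p → p ∈ Q → q ∈ Q

/-- The down-closure of the non-leaking part of `Q`. -/
def downBlock : Set (PtR ι ρ ν κ) := {q | ∃ p, p ∈ Q ∧ ¬ Leak p arm ∧ q ≤ p}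

variable {arm Q}

/-- A lower set is block-lower. -/
lemma BlockLower.of_isLowerSet (hQ : IsLowerSet Q) : BlockLower arm Q :=
  fun _ _ _ _ hle hp => hQ hle hp

/-- The down-closure is a lower set. -/
lemma isLowerSet_downBlock : IsLowerSet (downBlock arm Q) := by
  rintro q q' hle ⟨p, hp, hL, hqp⟩
  exact ⟨p, hp, hL, le_trans hle hqp⟩

/-- On the non-leaking points, the down-closure of a block-lower `Q` is `Q`. -/
lemma mem_downBlock_iff (hQ : BlockLower arm Q) {q : PtR ι ρ ν κ} (hq : ¬ Leak q arm) :
    q ∈ downBlock arm Q ↔ q ∈ Q := by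
  constructor
  · rintro ⟨p, hp, hL, hqp⟩
    exact hQ p q hL hq hqp hp
  · intro h
    exact ⟨q, h, hq, le_rfl⟩

/-- The source of a `G5` instance is a T-slab point (every arm dropped), hence non-leaking. -/
lemma not_leak_G5_src (a : Config ν) (e : ρ → Bool) (f : Config κ) :
    ¬ Leak (((fun _ => true) : Config ι), a, (fun _ => false), e, f) arm :=
  not_leak_of_tslab arm ⟨rfl, fun _ => Or.inl rfl⟩

/-- The target of a `G5` instance is a B-slab point (every arm attached red), hence non-leaking. -/
lemma not_leak_G5_tgt (a : Config ν) (e : ρ → Bool) (f : Config κ) :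
    ¬ Leak (((fun _ => false) : Config ι), a, (fun _ => true), e, f) arm :=
  not_leak_of_bslab arm ⟨rfl, fun _ => Or.inl rfl⟩

/-- `G5` passes to the down-closure. -/
lemma G5_downBlock (hQ : BlockLower arm Q) (hG : G5 Q) : G5 (downBlock arm Q) := by
  intro a e f h
  rw [mem_downBlock_iff hQ (not_leak_G5_src a e f)] at h
  rw [mem_downBlock_iff hQ (not_leak_G5_tgt a e f)]
  exact hG a e f h

variable [Nonempty ι] [Fintype ι] [DecidableEq ι] [Fintype ρ] [DecidableEq ρ] [Fintype ν]
  [DecidableEq ν] [Fintype κ] [DecidableEq κ]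

/-- **The several-arms big-block lemma, block-lowerness form**: lowerness is only needed between
non-leaking points. -/
theorem mixedArms_card_le' (hQ : BlockLower arm Q) (hG : G5 Q) {𝓔 : Set (Set (AtomR ι ρ ν κ))}
    (h𝓔 : IsUpperSet 𝓔) :
    (Finset.univ.filter fun p : PtR ι ρ ν κ => p ∈ Q ∧ ¬ Leak p arm ∧ ER p ∈ 𝓔).card ≤
      (Finset.univ.filter fun p : PtR ι ρ ν κ => p ∈ Q ∧ ¬ Leak p arm ∧ EB p ∈ 𝓔).card := by
  have key := mixedArms_card_le (arm := arm) (isLowerSet_downBlock (arm := arm) (Q := Q))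
    (G5_downBlock hQ hG) h𝓔
  have e1 : ∀ R : PtR ι ρ ν κ → Prop,
      (Finset.univ.filter fun p : PtR ι ρ ν κ => p ∈ downBlock arm Q ∧ ¬ Leak p arm ∧ R p) =
        (Finset.univ.filter fun p : PtR ι ρ ν κ => p ∈ Q ∧ ¬ Leak p arm ∧ R p) := by
    intro R
    apply Finset.filter_congr
    intro p _
    constructor
    · rintro ⟨h1, h2, h3⟩
      exact ⟨(mem_downBlock_iff hQ h2).1 h1, h2, h3⟩
    · rintro ⟨h1, h2, h3⟩
      exact ⟨(mem_downBlock_iff hQ h2).2 h1, h2, h3⟩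
  rw [e1 (fun p => ER p ∈ 𝓔), e1 (fun p => EB p ∈ 𝓔)] at key
  exact key

end BlockLower

section Transfer

open LocRows

variable {V : Type*} {E : Type*} [Fintype E]
variable [Nonempty ι] [Fintype ι] [DecidableEq ι] [Fintype ρ] [DecidableEq ρ] [Fintype ν]
  [DecidableEq ν] [Fintype κ] [DecidableEq κ] {arm : ν → ρ}

/-- **The several-arms big-block principle, edge-set form**: a block `C` of configurations that is
the injective image of the non-leaking points of the several-arms raw cube under a realisation
`r`, on which the red edge set of `h` is the image of the abstract red set `ER` under a monotone
map `φ` of atom sets to edge sets (and the blue edge set the image of `EB`), and whose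
conditioning pulls back to a block-lower set with `G5`, satisfies the rigid counting inequality on
`C ∩ Qs` for every up-set `𝓔` of edge sets — the several-arms twin of
`BigBlock.card_le_of_mixedCore_edges`; a geometric chain for a junction with several mixed arms
only has to build `r` and `φ` and check these hypotheses. -/
theorem card_le_of_mixedArms_edges {ends : E → Sym2 V} (r : PtR ι ρ ν κ → Config E)
    (hr : ∀ p q, ¬ Leak p arm → ¬ Leak q arm → r p = r q → p = q) (C : Finset (Config E))
    (hC : ∀ ζ, ζ ∈ C ↔ ∃ p, ¬ Leak p arm ∧ r p = ζ) (Qs : Set (Config E))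
    (hEv : ∀ p q, ¬ Leak p arm → ¬ Leak q arm → q ≤ p → r p ∈ Qs → r q ∈ Qs)
    (hG : G5 {p | r p ∈ Qs}) (h : V)
    (φ : Set (AtomR ι ρ ν κ) → Set E) (hφ : Monotone φ)
    (hR : ∀ p, ¬ Leak p arm → redEdges ends (r p) h = φ (ER p))
    (hB : ∀ p, ¬ Leak p arm → blueEdges ends (r p) h = φ (EB p))
    {𝓔 : Set (Set E)} (h𝓔 : IsUpperSet 𝓔) :
    (C.filter fun ζ => ζ ∈ Qs ∧ redEdges ends ζ h ∈ 𝓔).card ≤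
      (C.filter fun ζ => ζ ∈ Qs ∧ blueEdges ends ζ h ∈ 𝓔).card := by
  have e1 : (C.filter fun ζ => ζ ∈ Qs ∧ redEdges ends ζ h ∈ 𝓔) =
      (Finset.univ.filter fun p : PtR ι ρ ν κ => r p ∈ Qs ∧ ¬ Leak p arm ∧ ER p ∈ φ ⁻¹' 𝓔).image r := by
    ext ζ
    simp only [Finset.mem_filter, Finset.mem_image, Finset.mem_univ, true_and, Set.mem_preimage]
    constructor
    · rintro ⟨hζ, hQ, hE⟩
      obtain ⟨p, hp, rfl⟩ := (hC ζ).1 hζ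
      refine ⟨p, ⟨hQ, hp, ?_⟩, rfl⟩
      rw [← hR p hp]
      exact hE
    · rintro ⟨p, ⟨hQ, hp, hE⟩, rfl⟩
      refine ⟨(hC _).2 ⟨p, hp, rfl⟩, hQ, ?_⟩
      rw [hR p hp]
      exact hE
  have e2 : (C.filter fun ζ => ζ ∈ Qs ∧ blueEdges ends ζ h ∈ 𝓔) =
      (Finset.univ.filter fun p : PtR ι ρ ν κ => r p ∈ Qs ∧ ¬ Leak p arm ∧ EB p ∈ φ ⁻¹' 𝓔).image r := by
    ext ζ
    simp only [Finset.mem_filter, Finset.mem_image, Finset.mem_univ, true_and, Set.mem_preimage]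
    constructor
    · rintro ⟨hζ, hQ, hE⟩
      obtain ⟨p, hp, rfl⟩ := (hC ζ).1 hζ
      refine ⟨p, ⟨hQ, hp, ?_⟩, rfl⟩
      rw [← hB p hp]
      exact hE
    · rintro ⟨p, ⟨hQ, hp, hE⟩, rfl⟩
      refine ⟨(hC _).2 ⟨p, hp, rfl⟩, hQ, ?_⟩
      rw [hB p hp]
      exact hE
  have inj1 : Set.InjOn r
      ↑(Finset.univ.filter fun p : PtR ι ρ ν κ => r p ∈ Qs ∧ ¬ Leak p arm ∧ ER p ∈ φ ⁻¹' 𝓔) := by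
    intro p hp q hq hpq
    simp only [Finset.coe_filter, Finset.mem_univ, true_and, Set.mem_setOf_eq] at hp hq
    exact hr p q hp.2.1 hq.2.1 hpq
  have inj2 : Set.InjOn r
      ↑(Finset.univ.filter fun p : PtR ι ρ ν κ => r p ∈ Qs ∧ ¬ Leak p arm ∧ EB p ∈ φ ⁻¹' 𝓔) := by
    intro p hp q hq hpq
    simp only [Finset.coe_filter, Finset.mem_univ, true_and, Set.mem_setOf_eq] at hp hq
    exact hr p q hp.2.1 hq.2.1 hpq
  rw [e1, e2, Finset.card_image_of_injOn inj1, Finset.card_image_of_injOn inj2]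
  have h𝓔' : IsUpperSet (φ ⁻¹' 𝓔) := by
    intro S S' hSS' hS
    exact h𝓔 (hφ hSS') hS
  exact mixedArms_card_le' hEv hG h𝓔'

end Transfer

end MixedArms

end Summit.Ventures.PercRepro2
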